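import Summits.AtomisticToContinuum.Crystallization.Theorems.HullExactificationCascadeHcpLandscapeGapStubBoundaryLayer

/-!
# Crux `HcpLandscapeGap` (route `HullExactificationCascade`, stmt-AtomisticToContinuum-12087),
# line `birth`: stub `stub_windowEnergySeparated` (SE-general) — the window sum of the full
# site energies of a separated set is at most twice the window energy plus a surface term

For a `7/10`-separated `S ⊆ ℝ³`, a centre `c`, a radius `L ≥ 0` and an injective enumeration
`x : Fin n → ℝ³` of the window `W = S ∩ B̄_L(c)`:

  `Σ_t Σ'_{z ∈ S, z ≠ x t} V_LJ(dist (x t) z) ≤ 2·𝓔_LJ(x) + C (L+1)²`, `C` absolute.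

Proof.  Fix `t`.  The full site family at `x t` is summable (`summable_lennardJones_site`) and its
terms at distance `> 2L + 1 ≥ 1` are `≤ 0`, so the full site sum is at most the finite sum over
the points `z ∈ S`, `z ≠ x t`, `dist z (x t) ≤ 2L + 1` (`tsum_site_le_sum_near`).  These split
into the window points `x k`, `k ≠ t` (every window point is within `2L` of `x t`), whose
contribution is exactly `siteEnergy V_LJ x t` (summing to `2·𝓔_LJ(x)` over `t`,
`two_mul_interactionEnergy`), and the outside points (`dist z c > L`): an outside point at
distance `> 1` contributes `≤ 0` (`lennardJones_nonpos`), one at distance `≤ 1` contributes at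
most `V₀ = (1/12)(10/7)¹²` (`V_LJ(r) ≤ (1/12) r⁻¹²`, `r ≥ 7/10`), and there are at most
`#{z ∈ S : dist z (x t) ≤ 1} ≤ (27/7)³` of the latter (`ncard_ball_le`), none at all unless
`L − 1 < dist (x t) c` (an outside point within `1` of `x t` has `L < dist z c ≤ 1 + dist (x t) c`).
The sites `x t` with `L − 1 < dist (x t) c` form the depth-`1` boundary layer of the window,
of cardinality `≤ C_b (L+1)²` (`stub_boundaryLayer` (i), `δ = 7/10`, `ρ = 1`).  Hence
`C = V₀ · (27/7)³ · C_b`.  All `[folklore]` (Blanc–Lewin 2015, §1.2–§1.3: cut-and-paste surface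
terms).
-/

noncomputable section

namespace Summit.AtomisticToContinuum.Crystallization.Theorems.HcpLandscapeGapBirth

open scoped BigOperators
open Set Metric
open Literature.MathematicalPhysics.StatisticalMechanics
open Summit.AtomisticToContinuum.Crystallization.Theorems.CoarseGrains.Negative.PredicateAPI (E3)
open Summit.AtomisticToContinuum.Crystallization.Theorems.HullBulkOptimal
  (summable_lennardJones_site ncard_ball_le tsum_site_le_sum_near)

namespace WindowEnergySeparated

/-- `V_LJ(r) ≤ (1/12)(10/7)¹²` for `r ≥ 7/10`: drop the attractive term and use
`r⁻¹ ≤ 10/7`. [folklore] -/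
theorem lennardJones_le_of_le {r : ℝ} (hr : 7 / 10 ≤ r) :
    lennardJones r ≤ 1 / 12 * (10 / 7 : ℝ) ^ 12 := by
  unfold lennardJones
  have h0 : 0 < r := by linarith
  have h1 : r⁻¹ ≤ 10 / 7 := by
    rw [inv_le_comm₀ h0 (by norm_num)]
    norm_num
    exact hr
  have h2 : 0 ≤ r⁻¹ := inv_nonneg.2 h0.le
  have h3 : (r⁻¹) ^ 12 ≤ (10 / 7 : ℝ) ^ 12 := pow_le_pow_left₀ h2 h1 12
  have h4 : 0 ≤ (r⁻¹) ^ 6 := pow_nonneg h2 6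
  nlinarith

/-- **Per-site bound.** For a `7/10`-separated `S ⊆ ℝ³`, an injective enumeration `x` of the
window `S ∩ B̄_L(c)` (`L ≥ 0`) and a site `t`: the full site sum `Σ'_{z ∈ S, z ≠ x t} V_LJ` is at
most `siteEnergy V_LJ x t + V₀ · #{z ∈ S : dist z (x t) ≤ 1, L < dist z c}` with
`V₀ = (1/12)(10/7)¹²` (truncate at radius `2L + 1` by `tsum_site_le_sum_near`; the window part
of the truncated sum is the site energy; an outside term is `≤ V₀` within distance `1` and `≤ 0`
beyond). [folklore] -/
theorem tsum_site_le {S : Set E3} (hsep : ∀ a ∈ S, ∀ b ∈ S, a ≠ b → 7 / 10 ≤ dist a b)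
    (c : E3) {L : ℝ} (hL : 0 ≤ L) {n : ℕ} {x : Fin n → E3} (hx : Function.Injective x)
    (hrange : Set.range x = {y : E3 | y ∈ S ∧ dist y c ≤ L}) (t : Fin n) :
    ∑' z : ↥({z : E3 | z ∈ S ∧ z ≠ x t} : Set E3), lennardJones (dist (x t) (z : E3)) ≤
      siteEnergy lennardJones x t + 1 / 12 * (10 / 7 : ℝ) ^ 12 *
        (({z : E3 | z ∈ S ∧ dist z (x t) ≤ 1 ∧ L < dist z c} : Set E3).ncard : ℝ) := by
  classical
  have hmem : ∀ k, x k ∈ S ∧ dist (x k) c ≤ L := fun k => by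
    have h : x k ∈ Set.range x := Set.mem_range_self k
    rw [hrange] at h
    exact h
  have hxt : x t ∈ S := (hmem t).1
  -- the points of `S` other than `x t` within `2L + 1` of `x t`: a finite set
  have hAfin : ({z : E3 | z ∈ S ∧ z ≠ x t ∧ dist z (x t) ≤ 2 * L + 1} : Set E3).Finite :=
    finite_of_forall_le_dist_of_subset_closedBall (by norm_num : (0 : ℝ) < 7 / 10)
      (fun p hp q hq hpq => hsep p hp.1 q hq.1 hpq) (c := x t) (R := 2 * L + 1)
      (fun p hp => mem_closedBall.2 hp.2.2)
  set F : Finset E3 := hAfin.toFinset with hF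
  have hFmem : ∀ z : E3, z ∈ F ↔ z ∈ S ∧ z ≠ x t ∧ dist z (x t) ≤ 2 * L + 1 := fun z =>
    Set.Finite.mem_toFinset hAfin
  have h1 := tsum_site_le_sum_near (by norm_num : (0 : ℝ) < 7 / 10) hsep hxt (ρ := 2 * L + 1)
    (by linarith) F hFmem
  refine h1.trans ?_
  rw [← Finset.sum_filter_add_sum_filter_not F (fun z => dist z c ≤ L)]
  -- the window part of the truncated sum is the site energy
  have hW : F.filter (fun z => dist z c ≤ L) = (Finset.univ.erase t).image x := by
    ext z
    simp only [Finset.mem_filter, hFmem, Finset.mem_image, Finset.mem_erase, Finset.mem_univ,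
      and_true]
    constructor
    · rintro ⟨⟨hzS, hzne, -⟩, hzc⟩
      have hz : z ∈ Set.range x := by
        rw [hrange]
        exact ⟨hzS, hzc⟩
      obtain ⟨k, rfl⟩ := hz
      exact ⟨k, fun h => hzne (congrArg x h), rfl⟩
    · rintro ⟨k, hk, rfl⟩
      refine ⟨⟨(hmem k).1, fun h => hk (hx h), ?_⟩, (hmem k).2⟩
      calc dist (x k) (x t) ≤ dist (x k) c + dist (x t) c := dist_triangle_right _ _ _
        _ ≤ L + L := add_le_add (hmem k).2 (hmem t).2
        _ ≤ 2 * L + 1 := by linarith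
  have hWsum : ∑ z ∈ F.filter (fun z => dist z c ≤ L), lennardJones (dist (x t) z) =
      siteEnergy lennardJones x t := by
    rw [hW, Finset.sum_image fun a _ b _ h => hx h, siteEnergy]
  -- the outside part: only points within distance `1` contribute positively
  set N : Set E3 := {z : E3 | z ∈ S ∧ dist z (x t) ≤ 1 ∧ L < dist z c} with hN
  have hNfin : N.Finite :=
    finite_of_forall_le_dist_of_subset_closedBall (by norm_num : (0 : ℝ) < 7 / 10)
      (fun p hp q hq hpq => hsep p hp.1 q hq.1 hpq) (c := x t) (R := 1)
      (fun p hp => mem_closedBall.2 hp.2.1)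
  have hterm : ∀ z ∈ F.filter (fun z => ¬ dist z c ≤ L), lennardJones (dist (x t) z) ≤
      if dist z (x t) ≤ 1 then 1 / 12 * (10 / 7 : ℝ) ^ 12 else 0 := by
    intro z hz
    obtain ⟨hzF, -⟩ := Finset.mem_filter.1 hz
    obtain ⟨hzS, hzne, -⟩ := (hFmem z).1 hzF
    split_ifs with hd
    · rw [dist_comm]
      exact lennardJones_le_of_le (hsep z hzS (x t) hxt hzne)
    · rw [dist_comm]
      exact lennardJones_nonpos (le_of_lt (not_le.1 hd))
  have hOsum : ∑ z ∈ F.filter (fun z => ¬ dist z c ≤ L), lennardJones (dist (x t) z) ≤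
      1 / 12 * (10 / 7 : ℝ) ^ 12 * (N.ncard : ℝ) := by
    refine (Finset.sum_le_sum hterm).trans ?_
    rw [Finset.sum_ite, Finset.sum_const_zero, add_zero, Finset.sum_const, nsmul_eq_mul,
      mul_comm]
    refine mul_le_mul_of_nonneg_left ?_ (by positivity)
    have hsub : (((F.filter (fun z => ¬ dist z c ≤ L)).filter (fun z => dist z (x t) ≤ 1) :
        Finset E3) : Set E3) ⊆ N := by
      intro z hz
      rw [Finset.mem_coe, Finset.mem_filter, Finset.mem_filter] at hz
      obtain ⟨⟨hzF, hzc⟩, hd⟩ := hz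
      exact ⟨((hFmem z).1 hzF).1, hd, not_le.1 hzc⟩
    have h := Set.ncard_le_ncard hsub hNfin
    rw [Set.ncard_coe_finset] at h
    exact_mod_cast h
  rw [hWsum]
  linarith

/-- **The near-outside set is small, and empty at depth `≥ 1`.** For a `7/10`-separated `S`,
`#{z ∈ S : dist z y ≤ 1, L < dist z c} ≤ (27/7)³` (`ncard_ball_le` with `r = 7/10`, `R = 1`),
and the set is empty if `dist y c ≤ L − 1` (then `dist z c ≤ 1 + dist y c ≤ L`). [folklore] -/
theorem ncard_near_outside_le {S : Set E3} (hsep : ∀ a ∈ S, ∀ b ∈ S, a ≠ b → 7 / 10 ≤ dist a b)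
    (c y : E3) (L : ℝ) :
    (({z : E3 | z ∈ S ∧ dist z y ≤ 1 ∧ L < dist z c} : Set E3).ncard : ℝ) ≤
      if L - 1 < dist y c then (27 / 7 : ℝ) ^ 3 else 0 := by
  split_ifs with hy
  · have hsub : ({z : E3 | z ∈ S ∧ dist z y ≤ 1 ∧ L < dist z c} : Set E3) ⊆
        {z : E3 | z ∈ S ∧ dist z y ≤ 1} := fun z hz => ⟨hz.1, hz.2.1⟩
    have hfin : ({z : E3 | z ∈ S ∧ dist z y ≤ 1} : Set E3).Finite :=
      finite_of_forall_le_dist_of_subset_closedBall (by norm_num : (0 : ℝ) < 7 / 10)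
        (fun p hp q hq hpq => hsep p hp.1 q hq.1 hpq) (c := y) (R := 1)
        (fun p hp => mem_closedBall.2 hp.2)
    have h1 : (({z : E3 | z ∈ S ∧ dist z y ≤ 1 ∧ L < dist z c} : Set E3).ncard : ℝ) ≤
        ({z : E3 | z ∈ S ∧ dist z y ≤ 1} : Set E3).ncard := by
      exact_mod_cast Set.ncard_le_ncard hsub hfin
    have h2 := ncard_ball_le (by norm_num : (0 : ℝ) < 7 / 10) hsep y (R := 1) zero_le_one
    calc (({z : E3 | z ∈ S ∧ dist z y ≤ 1 ∧ L < dist z c} : Set E3).ncard : ℝ)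
        ≤ ({z : E3 | z ∈ S ∧ dist z y ≤ 1} : Set E3).ncard := h1
      _ ≤ (2 * 1 / (7 / 10) + 1) ^ 3 := h2
      _ = (27 / 7 : ℝ) ^ 3 := by norm_num
  · have hempty : ({z : E3 | z ∈ S ∧ dist z y ≤ 1 ∧ L < dist z c} : Set E3) = ∅ := by
      refine Set.eq_empty_of_forall_notMem fun z hz => ?_
      have h3 := dist_triangle z y c
      linarith [hz.2.1, hz.2.2, not_lt.1 hy]
    rw [hempty, Set.ncard_empty, Nat.cast_zero]

end WindowEnergySeparated

open WindowEnergySeparated in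
/-- **Stub SE-general — the window sum of the full site energies of a separated set.**  There is
an absolute constant `C` such that for every `7/10`-separated `S ⊆ ℝ³`, every centre `c`, every
radius `L ≥ 0` and every injective enumeration `x : Fin n → ℝ³` of the window `S ∩ B̄_L(c)`:
`Σ_t Σ'_{z ∈ S, z ≠ x t} V_LJ(dist (x t) z) ≤ 2·𝓔_LJ(x) + C (L+1)²` (sitewise
`WindowEnergySeparated.tsum_site_le`; the site energies sum to `2·𝓔_LJ(x)` by
`two_mul_interactionEnergy`; the near-outside counts vanish off the depth-`1` boundary layer and
are `≤ (27/7)³` on it, `WindowEnergySeparated.ncard_near_outside_le`, and the layer has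
`≤ C_b (L+1)²` sites, `stub_boundaryLayer` (i) with `δ = 7/10`, `ρ = 1`;
`C = (1/12)(10/7)¹² · (27/7)³ · C_b`). [folklore] -/
theorem stub_windowEnergySeparated : ∃ C : ℝ, ∀ S : Set (EuclideanSpace ℝ (Fin 3)), (∀ p ∈ S, ∀ q ∈ S, p ≠ q → 7 / 10 ≤ dist p q) → ∀ (c : EuclideanSpace ℝ (Fin 3)) (L : ℝ), 0 ≤ L → ∀ (n : ℕ) (x : Fin n → EuclideanSpace ℝ (Fin 3)), Function.Injective x → Set.range x = {p : EuclideanSpace ℝ (Fin 3) | p ∈ S ∧ dist p c ≤ L} → ∑ t : Fin n, (∑' z : ↥{z : EuclideanSpace ℝ (Fin 3) | z ∈ S ∧ z ≠ x t}, Literature.MathematicalPhysics.StatisticalMechanics.lennardJones (dist (x t) (z : EuclideanSpace ℝ (Fin 3)))) ≤ 2 * Literature.MathematicalPhysics.StatisticalMechanics.interactionEnergy Literature.MathematicalPhysics.StatisticalMechanics.lennardJones x + C * (L + 1) ^ 2 := by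
  classical
  obtain ⟨Cb, hCb⟩ := stub_boundaryLayer (7 / 10) (by norm_num) 1 zero_le_one
  refine ⟨1 / 12 * (10 / 7 : ℝ) ^ 12 * (27 / 7 : ℝ) ^ 3 * Cb, fun S hsep c L hL n x hx hrange => ?_⟩
  have hmem : ∀ k, x k ∈ S ∧ dist (x k) c ≤ L := fun k => by
    have h : x k ∈ Set.range x := Set.mem_range_self k
    rw [hrange] at h
    exact h
  -- the near-outside counts sum to a surface term
  have hcount : ∑ t : Fin n,
      (({z : E3 | z ∈ S ∧ dist z (x t) ≤ 1 ∧ L < dist z c} : Set E3).ncard : ℝ) ≤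
      (27 / 7 : ℝ) ^ 3 * (Cb * (L + 1) ^ 2) := by
    calc ∑ t : Fin n, (({z : E3 | z ∈ S ∧ dist z (x t) ≤ 1 ∧ L < dist z c} : Set E3).ncard : ℝ)
        ≤ ∑ t : Fin n, (if L - 1 < dist (x t) c then (27 / 7 : ℝ) ^ 3 else 0) :=
          Finset.sum_le_sum fun t _ => ncard_near_outside_le hsep c (x t) L
      _ = (27 / 7 : ℝ) ^ 3 *
            ((Finset.univ.filter fun t : Fin n => L - 1 < dist (x t) c).card : ℝ) := by
          rw [Finset.sum_ite, Finset.sum_const_zero, add_zero, Finset.sum_const, nsmul_eq_mul,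
            mul_comm]
      _ ≤ (27 / 7 : ℝ) ^ 3 * (Cb * (L + 1) ^ 2) := by
          refine mul_le_mul_of_nonneg_left (le_trans (le_of_eq ?_) (hCb S hsep c L hL).1)
            (by positivity)
          -- the layer sites are enumerated injectively by the `t` with `L - 1 < dist (x t) c`
          have hset : (((Finset.univ.filter fun t : Fin n => L - 1 < dist (x t) c).image x :
              Finset E3) : Set E3) = {y : E3 | y ∈ S ∧ dist y c ≤ L ∧ L - 1 < dist y c} := by
            ext y
            simp only [Finset.coe_image, Finset.coe_filter, Finset.mem_univ, true_and,
              Set.mem_image, Set.mem_setOf_eq]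
            constructor
            · rintro ⟨t, ht, rfl⟩
              exact ⟨(hmem t).1, (hmem t).2, ht⟩
            · rintro ⟨hyS, hyc, hyl⟩
              have hy : y ∈ Set.range x := by
                rw [hrange]
                exact ⟨hyS, hyc⟩
              obtain ⟨t, rfl⟩ := hy
              exact ⟨t, hyl, rfl⟩
          rw [← Finset.card_image_of_injective _ hx, ← Set.ncard_coe_finset, hset]
  have hV₀ : (0 : ℝ) ≤ 1 / 12 * (10 / 7 : ℝ) ^ 12 := by positivity
  have hkey := mul_le_mul_of_nonneg_left hcount hV₀
  calc ∑ t : Fin n, (∑' z : ↥({z : E3 | z ∈ S ∧ z ≠ x t} : Set E3),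
          lennardJones (dist (x t) (z : E3)))
      ≤ ∑ t : Fin n, (siteEnergy lennardJones x t + 1 / 12 * (10 / 7 : ℝ) ^ 12 *
          (({z : E3 | z ∈ S ∧ dist z (x t) ≤ 1 ∧ L < dist z c} : Set E3).ncard : ℝ)) :=
        Finset.sum_le_sum fun t _ => tsum_site_le hsep c hL hx hrange t
    _ = 2 * interactionEnergy lennardJones x + 1 / 12 * (10 / 7 : ℝ) ^ 12 *
          ∑ t : Fin n, (({z : E3 | z ∈ S ∧ dist z (x t) ≤ 1 ∧ L < dist z c} : Set E3).ncard : ℝ) := by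
        rw [Finset.sum_add_distrib, ← two_mul_interactionEnergy, ← Finset.mul_sum]
    _ ≤ 2 * interactionEnergy lennardJones x +
          1 / 12 * (10 / 7 : ℝ) ^ 12 * (27 / 7 : ℝ) ^ 3 * Cb * (L + 1) ^ 2 := by
        nlinarith [hkey]

end Summit.AtomisticToContinuum.Crystallization.Theorems.HcpLandscapeGapBirth

end
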